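import Summits.BirchSwinnertonDyer.BirchSwinnertonDyer.Theorems.EisensteinPrimesFullDescentHerbrandSplitting
import Summits.BirchSwinnertonDyer.BirchSwinnertonDyer.Theorems.EisensteinPrimesFullDescentTateAlgebraPrime
import Summits.BirchSwinnertonDyer.BirchSwinnertonDyer.Theorems.EisensteinPrimesFullDescentOrdinaryAtPrime
import Summits.BirchSwinnertonDyer.BirchSwinnertonDyer.Theorems.EisensteinPrimesFullDescentTheoremB
import HarnessLib

/-!
# Route `EisensteinPrimes`, crux 2 `GoodLatticeBDPValue` (stmt-BirchSwinnertonDyer-19032), line `halves` v25, road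
# R5 / AN-5 — **THEOREM B at an ODD prime `p`: Case `𝟙` ⇒ Case `ω`** (the `3 ↦ p` port of `FullDescentTheoremB`)

Cell `bsd-eis` (home `run/shared/lean/pub/bsd-eis/`), width seat `bsd-line-x1-p1-w6` (gen 8; `--supports -19032 --as
helper`, closes nothing by itself). Brick B_p of the NORMALISATION-FREE form T⁗ of width seat -w7 g7's theorem T‴ (road
R5 / AN-5, bus `STATUS.md` 2026-08-28 21:34:45Z / 22:03:35Z / 22:12:53Z): for `E/ℚ` with good ORDINARY reduction at the
odd prime `p`, every finite place `v ∤ p` good or SPLIT multiplicative with residue characteristic `ℓ ≢ 1 (mod p)`, and a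
`Γ_ℚ`-FIXED point `P ≠ 0` of `E[p]`, there is a point `Q ≠ 0` of `E[p]` on which `Γ_ℚ` acts through `χ̄_p` — the
sequence `0 → ⟨P⟩ → E[p] → μ_p → 0` splits. LEAD g5's `FullDescentTheoremB.exists_omega_point_of_fixed_point` is the
case `p = 3`, where the splitting came from KUMMER theory (`FullDescentKummerSplitting.exists_stable_complement`); at an odd
`p` it comes from HERBRAND's theorem in Mazur's form (`Literature.….Mazur1977_herbrand`, `p ∤ B₂`), through -w7 g7's
relative splitting lemma `FullDescentHerbrandSplitting.exists_stable_complement` (same interface, `(3, 9) ↦ (p, p²)`).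
Assembly of landed bricks, token for token the `p = 3` file:

* B1ₚ (split `ℓ ≢ 1 (mod p)`): the Tate basis of `E[p]` at `v` (`FullDescentTateBasis.exists_tateBasis_geomPoints_
  of_hasSplitMultiplicativeReductionAt`, any level) and the algebra (T-a)ₚ (w3 g13,
  `FullDescentTateAlgebra.smul_eq_self_of_fixed_prime`): a fixed `P ≠ 0` forces the local inertia group to act TRIVIALLY
  on `E[p]` (`χ̄_p(Frob_ℓ) = ℓ ≢ 1`, `χ̄_p` unramified at `ℓ`); at a good `v ∤ p` inertia is trivial by
  Néron–Ogg–Shafarevich (`smul_eq_of_mem_absInertia_of_hasGoodReductionAt`);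
* B2ₚ (at `p`): Serre's ordinary line `Λ` (w4 g6, `FullDescentOrdinaryNine.Rat.exists_ordinary_reduction_kernels_of_
  hasGoodReductionAtPrime`, any odd `p`): stable under the decomposition group, inertia acts on it through `χ̄_p` — with
  the value `2` attained (w3 g13, `Rat.exists_mem_absInertia_val_eq_two_prime`), so `Λ ∩ ⟨P⟩ = 0`;
* B3ₚ: the Herbrand splitting lemma at `(L, N, M) = (0, ⟨P⟩, E[p])` in `V = E(ℚ̄)`, `B₀ = Λ`; the `Γ_ℚ`-stable
  complement `B` carries `χ̄_p` by the shape `(𝟙 *; 0 χ̄_p)` of `E[p]` along `⟨P⟩`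
  (`Mazur1978.smul_sub_smul_mem_zmultiples_of_isogenyCharacter` with `r = 𝟙`) and `B ∩ ⟨P⟩ = 0`.

USE (bus 22:12:53Z): with -w7 g7's `theoremA_prime` (Case `ω` ⇒ ⊥) and the landed T′ at `p = 3`, Theorem Bₚ gives the
full-descent datum «additive prime, or multiplicative `ℓ` with `a_ℓ ≡ ℓ (mod p)`» for EVERY odd good `p` with `E[p]`
reducible, WITHOUT the normalisation «no rational `p`-line unramified at `p`» of T‴ — Ribet–Yoo necessity with no side
condition; count-neutral for the skeleton (the consumer `KellerYin2024.thm222_anacong_goodLattice_of_five_le` carries the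
normalisation anyway), but it lets the [AN] join feed 3a-A at every odd `p` by one datum theorem.

HONEST FRAMING: helper theorems only (0 definitions, 0 named facts, 0 sorry); no summit statement, no BSD / IMC /
Keller–Yin theorem and no stub of the registered skeleton is proved by this file. References: [Mazur1977] III §5 (Herbrand);
[Kriz2016] Thm. 34; [SilvermanATAEC1994] V.3.1, Lemma V.5.2, Thm. V.5.3; [SilvermanAEC2009] VII.4.1;
[SerreInventiones1972] §1.11 Prop. 11; [Mazur1978] §5; [NeukirchANT1999] II §9 (9.6).
-/

set_option autoImplicit false

-- the route's Theorems namespace repeats the summit name by design (D-0017 nested layout)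
set_option linter.dupNamespace false

noncomputable section

open scoped Classical NumberField

namespace Summit.BirchSwinnertonDyer.BirchSwinnertonDyer.Theorems.FullDescentTheoremBPrime

open NumberField IsDedekindDomain Field WeierstrassCurve Rat.HeightOneSpectrum
  Literature.NumberTheory.EllipticCurves Literature.NumberTheory.GaloisRepresentations
  Summit.BirchSwinnertonDyer.BirchSwinnertonDyer.Theorems

variable (W : WeierstrassCurve ℚ) [W.IsElliptic] {p : ℕ} [hp : Fact p.Prime]

/-! ## §1. The shape `(𝟙 *; 0 χ̄_p)` of `E[p]` along a fixed point, in `E(ℚ̄)` -/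

/-- For a `Γ_ℚ`-fixed `P ≠ 0` in `E[p]` and every `x ∈ E[p]`: `σ x − χ̄_p(σ) x ∈ ⟨P⟩` (as points of `E(ℚ̄)`), by the
shape `(r *; 0 χ̄ r⁻¹)` with `r = 𝟙`. [cite: Mazur1978, §5 (p. 148) and §6 proof of Prop. 6.3 (p. 153)] -/
theorem smul_sub_chi_smul_mem_zmultiples {P : geomTorsion W (p : ℤ)} (hP0 : P ≠ 0)
    (hfix : ∀ σ : absoluteGaloisGroup ℚ, σ • P = P) (σ : absoluteGaloisGroup ℚ)
    {x : geomPoints W} (hx : x ∈ geomTorsion W (p : ℤ)) :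
    σ • x - (((modNCyclotomicCharacter ℚ p σ : (ZMod p)ˣ) : ZMod p).val : ℤ) • x ∈
      AddSubgroup.zmultiples (P : geomPoints W) := by
  -- adapted from LEAD g5's `FullDescentTheoremB.smul_sub_chi_smul_mem_zmultiples` (p = 3)
  have hpp : p.Prime := hp.out
  haveI : Fact (1 < p) := ⟨hpp.one_lt⟩
  have hr : ∀ τ : absoluteGaloisGroup ℚ, τ • P = (((1 : absoluteGaloisGroup ℚ →* (ZMod p)ˣ) τ : (ZMod p)ˣ) :
      ZMod p).val • P := fun τ ↦ by
    rw [MonoidHom.one_apply, Units.val_one, ZMod.val_one, one_smul, hfix τ]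
  have h := Mazur1978.smul_sub_smul_mem_zmultiples_of_isogenyCharacter W p hP0 hr σ ⟨x, hx⟩
  rw [modPCyclotomicCharacterZMod_eq_modNCyclotomicCharacter, MonoidHom.one_apply, inv_one, Units.val_one,
    mul_one] at h
  obtain ⟨k, hk⟩ := AddSubgroup.mem_zmultiples_iff.mp h
  refine AddSubgroup.mem_zmultiples_iff.mpr ⟨k, ?_⟩
  have hk' := congrArg (Subtype.val : geomTorsion W (p : ℤ) → geomPoints W) hk
  simp only [AddSubgroupClass.coe_sub, AddSubgroup.torsionBy.coe_smul] at hk'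
  rw [hk', natCast_zsmul]

/-! ## §2. B1ₚ: at a split multiplicative `ℓ ≢ 1 (mod p)`, a fixed `P ≠ 0` makes `E[p]` unramified -/

/-- `(χ̄_p(res τ)).val ≡ 1` integrally iff `≡ 1 (mod p)`: if `p ∣ (u.val : ℤ) − 1` for `u = (ℓ : ℤ/p)` then
`ℓ ≡ 1 (mod p)`. [folklore] -/
theorem modEq_one_of_dvd_val_sub_one {ℓ : ℕ} (h : (p : ℤ) ∣ (((ℓ : ZMod p)).val : ℤ) - 1) : ℓ ≡ 1 [MOD p] := by
  have hpp : p.Prime := hp.out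
  haveI : NeZero p := ⟨hpp.ne_zero⟩
  have h0 : ((((((ℓ : ZMod p)).val : ℤ) - 1 : ℤ)) : ZMod p) = 0 := (ZMod.intCast_zmod_eq_zero_iff_dvd _ p).mpr h
  rw [Int.cast_sub, Int.cast_natCast, ZMod.natCast_zmod_val, Int.cast_one, sub_eq_zero] at h0
  rw [← ZMod.natCast_eq_natCast_iff, Nat.cast_one]
  exact h0

/-- **B1ₚ.** `W/ℚ` split multiplicative at the place `v` with `ℓ_v ≠ p`, `ℓ_v ≢ 1 (mod p)`, `P ≠ 0` a `Γ_ℚ`-fixed point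
of `E[p]`: every element of the local inertia group `I_{ℚ_v}` (restricted to `Γ_ℚ`) acts trivially on `E[p]` — Tate
basis `(P₁, P₂)` with `res τ • P₁ = χ̄_p(res τ) P₁`, `res τ • P₂ = P₂ + κ(τ) P₁`, a Frobenius has `χ̄_p = ℓ ≢ 1`,
inertia has `χ̄_p = 1`, and (T-a)ₚ. [cite: SilvermanATAEC1994, Thm. V.3.1 (c),(d), Lemma V.5.2, Thm. V.5.3]
[cite: NeukirchANT1999, Ch. I §10 (10.3), Ch. II §9 Prop. (9.6)] -/
theorem smul_eq_of_mem_absInertia_of_split_of_fixed {v : HeightOneSpectrum (𝓞 ℚ)} (hvp : natGenerator v ≠ p)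
    (hsplit : W.HasSplitMultiplicativeReductionAt v) (hmod : ¬ natGenerator v ≡ 1 [MOD p])
    {P : geomPoints W} (hPp : ((p : ℕ) : ℤ) • P = 0) (hP0 : P ≠ 0) (hfix : ∀ σ : absoluteGaloisGroup ℚ, σ • P = P)
    {τ : absoluteGaloisGroup (v.adicCompletion ℚ)} (hτ : τ ∈ absInertia (v.adicCompletion ℚ))
    {x : geomPoints W} (hx : ((p : ℕ) : ℤ) • x = 0) :
    absGaloisRestrict ℚ (v.adicCompletion ℚ) τ • x = x := by
  -- adapted from LEAD g5's `FullDescentTheoremB.smul_eq_of_mem_absInertia_of_split_of_fixed` (p = 3)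
  have hpp : p.Prime := hp.out
  haveI : NeZero p := ⟨hpp.ne_zero⟩
  haveI : Fact (1 < p) := ⟨hpp.one_lt⟩
  haveI hℓ : Fact (primesEquiv v : ℕ).Prime := ⟨(primesEquiv v).2⟩
  have hv : ((primesEquiv v : Nat.Primes) : ℕ) = natGenerator v := rfl
  -- the Tate basis of `E[p]`
  obtain ⟨P₁, P₂, κ, -, -, hgen, hrel, hP₁, hP₂⟩ :=
    FullDescentTateBasis.exists_tateBasis_geomPoints_of_hasSplitMultiplicativeReductionAt W v hsplit (N := p)
  -- the composite action of `Γ_{ℚ_v}` on `E(ℚ̄)` through `res`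
  letI inst : DistribMulAction (absoluteGaloisGroup (v.adicCompletion ℚ)) (geomPoints W) :=
    DistribMulAction.compHom _ (absGaloisRestrict ℚ (v.adicCompletion ℚ)).toMonoidHom
  have hdef : ∀ (σ : absoluteGaloisGroup (v.adicCompletion ℚ)) (y : geomPoints W),
      σ • y = absGaloisRestrict ℚ (v.adicCompletion ℚ) σ • y := fun _ _ ↦ rfl
  set χ : absoluteGaloisGroup (v.adicCompletion ℚ) → ℤ := fun σ ↦
    (((modNCyclotomicCharacter ℚ p (absGaloisRestrict ℚ (v.adicCompletion ℚ) σ) : (ZMod p)ˣ) : ZMod p).val : ℤ)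
    with hχ
  set κ' : absoluteGaloisGroup (v.adicCompletion ℚ) → ℤ := fun σ ↦ (κ σ : ℤ) with hκ'
  have hgen' : ∀ Q : geomPoints W, (p : ℤ) • Q = 0 → ∃ a b : ℤ, Q = a • P₁ + b • P₂ := fun Q hQ ↦
    hgen Q (by simpa using hQ)
  have hrel' : ∀ a b : ℤ, a • P₁ + b • P₂ = 0 ↔ (p : ℤ) ∣ a ∧ (p : ℤ) ∣ b := fun a b ↦ by
    simpa using hrel a b
  have hP₁' : ∀ σ : absoluteGaloisGroup (v.adicCompletion ℚ), σ • P₁ = χ σ • P₁ := fun σ ↦ by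
    rw [hdef, hP₁ σ, hχ, natCast_zsmul]
  have hP₂' : ∀ σ : absoluteGaloisGroup (v.adicCompletion ℚ), σ • P₂ = P₂ + κ' σ • P₁ := fun σ ↦ by
    rw [hdef, hP₂ σ, hκ', natCast_zsmul]
  -- a Frobenius: `χ̄_p(res σ₀) = ℓ ≢ 1`
  obtain ⟨𝔐, h𝔐⟩ := v.localPrimesAbove_nonempty
  obtain ⟨σ₀, hσ₀⟩ := IsDedekindDomain.HeightOneSpectrum.exists_isArithFrobAt_localAbsIntegers v h𝔐
  have hℓp : ¬ natGenerator v ∣ p := fun h ↦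
    hvp ((Nat.prime_dvd_prime_iff_eq (prime_natGenerator v) hpp).mp h)
  have hχσ₀ : χ σ₀ = ((((natGenerator v : ℕ) : ZMod p)).val : ℤ) := by
    have h := EisensteinPrimesLinePsiAtMultiplicativePrime.modNCyclotomicCharacter_absGaloisRestrict_frob
      (p := natGenerator v) hv h𝔐 hσ₀ p hℓp
    simp only [hχ]
    rw [h]
  have hσ₀' : ¬ (p : ℤ) ∣ χ σ₀ - 1 := fun h ↦ hmod (modEq_one_of_dvd_val_sub_one (p := p) (by rwa [hχσ₀] at h))
  -- inertia: `χ̄_p(res τ) = 1`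
  have hpv : ((p : ℕ) : 𝓞 ℚ) ∉ v.asIdeal := fun h ↦ hℓp ((Rat.natCast_mem_asIdeal_iff v).mp h)
  haveI : NeZero ((p : ℕ) : ℚ) := ⟨by exact_mod_cast hpp.ne_zero⟩
  have hχτ : (p : ℤ) ∣ χ τ - 1 := by
    have h := Literature.NumberTheory.GaloisCohomology.modNCyclotomicCharacter_absGaloisRestrict_eq_one_of_mem_absInertia
      ℚ p v hpv hτ
    simp only [hχ]
    rw [h, Units.val_one, ZMod.val_one]
    simp
  have hfix' : ∀ σ : absoluteGaloisGroup (v.adicCompletion ℚ), σ • P = P := fun σ ↦ by rw [hdef, hfix]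
  have key := FullDescentTateAlgebra.smul_eq_self_of_fixed_prime hgen' hrel' hP₁' hP₂' hσ₀'
    (by simpa using hPp) hP0 hfix' hχτ (x := x) (by simpa using hx)
  rwa [hdef] at key

/-! ## §3. Theorem Bₚ -/

/-- **Theorem Bₚ (road R5 / AN-5, Case `𝟙` ⇒ Case `ω`, every odd `p`).** `W/ℚ` globally minimal with good ORDINARY
reduction at the odd prime `p`; every finite place `v ∤ p` good, or split multiplicative with residue characteristic
`≢ 1 (mod p)`; `P ≠ 0` a `Γ_ℚ`-fixed point of `E[p]`. Then some `Q ≠ 0` in `E[p]` carries the character `χ̄_p`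
(`σ Q = χ̄_p(σ) Q`): the sequence `0 → ⟨P⟩ → E[p] → μ_p → 0` splits over `Γ_ℚ` — Herbrand splitting
(`FullDescentHerbrandSplitting.exists_stable_complement`, from `Mazur1977_herbrand`) fed with B1ₚ
(`smul_eq_of_mem_absInertia_of_split_of_fixed`, Néron–Ogg–Shafarevich at the good places) and B2ₚ (Serre's ordinary line
`Λ`, which meets `⟨P⟩` trivially since inertia acts on it through `χ̄_p ≠ 𝟙`). [cite: Mazur1977, III §5 (Herbrand, p ∤ B₂)]
[cite: Kriz2016, Thm. 34 (2)–(3)] [cite: SerreInventiones1972, §1.11 Prop. 11] -/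
theorem exists_omega_point_of_fixed_point [W.IsGloballyMinimal] (hp2 : p ≠ 2)
    (hgood : W.HasGoodReductionAtPrime p) (hord : ¬ (p : ℤ) ∣ W.frobeniusTrace p)
    (hH : ∀ v : HeightOneSpectrum (𝓞 ℚ), natGenerator v ≠ p →
      W.HasGoodReductionAt v ∨ (W.HasSplitMultiplicativeReductionAt v ∧ ¬ natGenerator v ≡ 1 [MOD p]))
    (P : geomTorsion W (p : ℤ)) (hP0 : P ≠ 0) (hfix : ∀ σ : absoluteGaloisGroup ℚ, σ • P = P) :
    ∃ Q : geomTorsion W (p : ℤ), Q ≠ 0 ∧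
      ∀ σ : absoluteGaloisGroup ℚ, σ • Q = ((modNCyclotomicCharacter ℚ p σ : (ZMod p)ˣ) : ZMod p).val • Q := by
  -- adapted from LEAD g5's `FullDescentTheoremB.exists_omega_point_of_fixed_point` (p = 3, Kummer ↦ Herbrand)
  have hpp : p.Prime := hp.out
  haveI : NeZero p := ⟨hpp.ne_zero⟩
  haveI : NeZero ((p : ℕ) : ℚ) := ⟨by exact_mod_cast hpp.ne_zero⟩
  have hP0' : (P : geomPoints W) ≠ 0 := fun h ↦ hP0 (Subtype.ext h)
  have hPM : (P : geomPoints W) ∈ geomTorsion W (p : ℤ) := P.2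
  have hPp : ((p : ℕ) : ℤ) • (P : geomPoints W) = 0 := mem_torsionBy_iff.mp P.2
  have hfixc : ∀ σ : absoluteGaloisGroup ℚ, σ • (P : geomPoints W) = P := fun σ ↦ by
    rw [← AddSubgroup.torsionBy.coe_smul, hfix σ]
  have hNM : AddSubgroup.zmultiples (P : geomPoints W) ≤ geomTorsion W (p : ℤ) :=
    AddSubgroup.zmultiples_le_of_mem hPM
  -- cardinalities
  have hcN : Nat.card (AddSubgroup.zmultiples (P : geomPoints W)) = p * 1 := by
    rw [Nat.card_zmultiples, AddSubgroup.addOrderOf_coe, addOrderOf_eq_of_ne_zero W p hP0, mul_one]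
  have hcM : Nat.card (geomTorsion W (p : ℤ)) = p ^ 2 * 1 := by
    rw [Literature.NumberTheory.EllipticCurves.natCard_geomTorsion W p, mul_one]
  -- the place above `p` and Serre's line there
  obtain ⟨v₀, hv₀'⟩ : ∃ v₀ : HeightOneSpectrum (𝓞 ℚ), primesEquiv v₀ = ⟨p, hpp⟩ :=
    ⟨(primesEquiv (R := 𝓞 ℚ)).symm ⟨p, hpp⟩, Equiv.apply_symm_apply _ _⟩
  have hv₀ : natGenerator v₀ = p := congrArg Subtype.val hv₀'
  have hpv₀ : ((p : ℕ) : 𝓞 ℚ) ∈ v₀.asIdeal := (Rat.natCast_mem_asIdeal_iff v₀).mpr (hv₀ ▸ dvd_refl _)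
  obtain ⟨Λ, K₂, hΛle, hΛcard, -, -, -, hΛst, -, -, -, -, hΛχ, -⟩ :=
    FullDescentOrdinaryNine.Rat.exists_ordinary_reduction_kernels_of_hasGoodReductionAtPrime W p hp2 hgood
      hord v₀ hpv₀
  -- `Λ ∩ ⟨P⟩ = 0`: inertia acts on `Λ` through `χ̄_p`, with the value `2` attained, but fixes `P`
  have hΛN : Λ ⊓ AddSubgroup.zmultiples (P : geomPoints W) = ⊥ := by
    rw [eq_bot_iff]
    intro x hx
    obtain ⟨hxΛ, hxN⟩ := AddSubgroup.mem_inf.mp hx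
    obtain ⟨τ, hτ, hτχ, -⟩ := FullDescentOrdinaryNine.Rat.exists_mem_absInertia_val_eq_two_prime (p := p) hp2 hv₀
    have h1 := hΛχ τ hτ x hxΛ
    rw [hτχ] at h1
    have hxfix : absGaloisRestrict ℚ (v₀.adicCompletion ℚ) τ • x = x := by
      obtain ⟨k, rfl⟩ := AddSubgroup.mem_zmultiples_iff.mp hxN
      rw [FullDescentTateAlgebra.smul_zsmul_comm, hfixc]
    rw [hxfix, two_nsmul] at h1
    rw [AddSubgroup.mem_bot]
    exact left_eq_add.mp h1
  -- the Herbrand splitting lemma at `(0, ⟨P⟩, E[p])`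
  obtain ⟨B, -, hBM, hBN, hNB, hBst⟩ := FullDescentHerbrandSplitting.exists_stable_complement (V := geomPoints W)
    hp2 ⊥ (AddSubgroup.zmultiples (P : geomPoints W)) (geomTorsion W (p : ℤ)) bot_le hNM one_ne_zero
    (by simp) hcN hcM
    (fun σ x hx ↦ by rw [(AddSubgroup.mem_bot).mp hx, smul_zero]; exact AddSubgroup.zero_mem _)
    (fun x hx ↦ by
      rw [AddSubgroup.mem_bot]
      exact mem_torsionBy_iff.mp hx)
    (fun σ x hx ↦ by
      obtain ⟨k, rfl⟩ := AddSubgroup.mem_zmultiples_iff.mp hx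
      rw [FullDescentTateAlgebra.smul_zsmul_comm, hfixc, sub_self]
      exact AddSubgroup.zero_mem _)
    (fun σ x hx ↦ smul_sub_chi_smul_mem_zmultiples W hP0 hfix σ hx)
    (fun x _ ↦ W.isOpen_stabilizer_point_holds x)
    (fun v hv ↦ by
      refine ⟨adicCompletionPrime ℚ v, adicCompletionPrime_mem_primesAbove ℚ v, fun τ hτ x hx ↦ ?_⟩
      rw [inertia_adicCompletionPrime_eq_map_absInertia ℚ v] at hτ
      obtain ⟨τ', hτ', rfl⟩ := Subgroup.mem_map.mp hτ
      rw [AddSubgroup.mem_bot, sub_eq_zero]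
      have hxp : ((p : ℕ) : ℤ) • x = 0 := mem_torsionBy_iff.mp hx
      rcases hH v hv with hgoodv | ⟨hsplit, hmod⟩
      · have hn : ((((p : ℕ) : ℤ)) : 𝓞 ℚ) ∉ v.asIdeal := by
          rw [Int.cast_natCast]
          exact fun h ↦ hv (((Nat.prime_dvd_prime_iff_eq (prime_natGenerator v) hpp).mp
            ((Rat.natCast_mem_asIdeal_iff v).mp h)))
        exact W.smul_eq_of_mem_absInertia_of_hasGoodReductionAt hgoodv hn hτ' hxp
      · exact smul_eq_of_mem_absInertia_of_split_of_fixed W hv hsplit hmod hPp hP0' hfixc hτ' hxp)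
    hv₀
    ⟨Λ, bot_le, hΛle, by rw [hΛcard, mul_one], hΛN, fun δ hδ x hx ↦ by
      obtain ⟨σ, rfl⟩ := (GreenbergSelmer.mem_decomp_iff v₀ δ).mp hδ
      exact hΛst σ x hx⟩
  -- `B ≠ 0`: otherwise `⟨P⟩ = E[p]`, of order `p ≠ p²`
  have hB0 : B ≠ ⊥ := by
    rintro rfl
    rw [sup_bot_eq] at hNB
    have h := congrArg (fun S : AddSubgroup (geomPoints W) ↦ Nat.card S) hNB
    simp only [hcN, hcM] at h
    have : p * 1 < p ^ 2 * 1 := by nlinarith [hpp.two_le]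
    omega
  obtain ⟨⟨q, hqB⟩, hq0⟩ := (AddSubgroup.ne_bot_iff_exists_ne_zero).mp hB0
  have hq0' : q ≠ 0 := fun h ↦ hq0 (Subtype.ext h)
  refine ⟨⟨q, hBM hqB⟩, fun h ↦ hq0' (congrArg Subtype.val h), fun σ ↦ Subtype.ext ?_⟩
  -- `σ q − χ̄_p(σ) q ∈ B ∩ ⟨P⟩ = 0`
  have hmemN := smul_sub_chi_smul_mem_zmultiples W hP0 hfix σ (hBM hqB)
  have hmemB : σ • q - (((modNCyclotomicCharacter ℚ p σ : (ZMod p)ˣ) : ZMod p).val : ℤ) • q ∈ B :=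
    B.sub_mem (hBst σ q hqB) (B.zsmul_mem hqB _)
  have h0 : σ • q - (((modNCyclotomicCharacter ℚ p σ : (ZMod p)ˣ) : ZMod p).val : ℤ) • q = 0 := by
    rw [← AddSubgroup.mem_bot, ← hBN]
    exact AddSubgroup.mem_inf.mpr ⟨hmemB, hmemN⟩
  rw [sub_eq_zero, natCast_zsmul] at h0
  rw [AddSubgroup.torsionBy.coe_smul, AddSubgroupClass.coe_nsmul]
  exact h0

end Summit.BirchSwinnertonDyer.BirchSwinnertonDyer.Theorems.FullDescentTheoremBPrime

end
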